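import Summits.QuantumAdvantage.QuantumAdvantage.Theorems.ShadowDialD
import Summits.QuantumAdvantage.AdviceFreeQNC0.SqrtDegreeHardness

/-! # ShadowDialE — REV1 add-on part 5/5 of the landing twins of NODE «ShadowDial» (decomp-qadv lens-2 g24; REV1 node file
`g24/ShadowDial.lean`, sha256 3bddce3e4848f5c8…; parts A–D are the critic-verified rev0 twins (node rev0 sha256 c1ef15d9c22c1bbf…);
generator `g24/tree/gen_twins.py`: namespace `Theses.ShadowDial` → `Theorems.ShadowDial`, §3b and the √-scale `qStrat` certificate copied
verbatim, nothing else).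
Content (REV1): §3b the SQUARE-ROOT SCALE — `ringHardOdd_two_sqrt K` (the characteristic-2 ring law ON THE ODD CLASS at `𝔽₂`-degree `D`,
`2D+4 ≤ K⌊√(n−1)⌋`, transported from `AdviceFreeQNC0.walkHardLinSqrt`), `sqrtBudget`, `StabF2S`, the stronger special piece `SqrtShadowLoss3`
PROVED (`sqrt_shadow_holds`), the smaller residual `SqrtTernaryLoss3`, `closesS` BY NAME (+ `closesBS`, `closesDS`), `splitS_iff`, `residualS_iff`,
the lattice `shadow_of_sqrt` (FS ⇒ F) / `sqrtTernary_of_ternary` (R ⇒ RS), and the matching family's √-scale certificate `q_not_F2S_zero`. -/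

set_option linter.dupNamespace false
noncomputable section
open scoped Classical

namespace Summit.QuantumAdvantage.QuantumAdvantage.Theorems.ShadowDial
open Finset
open Literature.Computability.QuantumComplexity Literature.Computability.QuantumComplexity.RingHLF
open Literature.Computability.MetaComplexity Literature.Computability.MetaComplexity.Smolensky
open Summit.QuantumAdvantage.AdviceFreeQNC0
open Summit.QuantumAdvantage.QuantumAdvantage.Theorems.AnchorDial (outB dev loss_shape_mono)
open Summit.QuantumAdvantage.QuantumAdvantage.Theorems.HolonomyDial (tPoly tPoly_apply tPoly_mem xorP xorP_mem
  xorP_apply_bool mono_singleton_apply indP indP_apply indP_mem)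
open Summit.QuantumAdvantage.QuantumAdvantage.Theorems.StabilizerDial (apIdx apStrat apStrat_mem apStrat_apply pad
  pad_mem rel_pad_iff winset_pad StabFew outB_pad_zero)
open Summit.QuantumAdvantage.QuantumAdvantage.Theorems.SparsityDial (real_loss_of_frac stabFew_mono_mr one_le_logpow)
open Summit.QuantumAdvantage.QuantumAdvantage.Theorems.ResponseDial (mem_dev_apStrat dev_pad_zero
  not_polylogSparse_of_agree)
open Summit.QuantumAdvantage.QuantumAdvantage.Theorems.CounterDial (CounterForm StabCounter)
open Summit.QuantumAdvantage.QuantumAdvantage.Theorems.AbelianDial (alin TableForm StabTable AbelianLoss3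
  NonAbelianLoss3 tableForm_of_counterForm nT pcell qcell pcell_val qcell_val pcell_injective qcell_injective
  pcell_ne_qcell qG qG_apply qG_indB qStrat qStrat_agree qStrat_mem6 q_in_dense_class mem_dev_q_second indB
  oddZeros_indB alin_indB q_not_tableForm_zero q_not_counterForm_zero)
open Summit.QuantumAdvantage.QuantumAdvantage.Theorems.ScaleDial (logpow_add_logpow_le)

variable {N : ℕ}

/-! ## §3b  THE SQUARE-ROOT SCALE: `RingHardOdd 2` at `𝔽₂`-degree `K·√n` for EVERY slope `K` (the tree types the
characteristic-2 ring law on the ODD class at POLYLOG degree — `ringHardOdd_two` — and on ALL inputs at `K√n` —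
`ringHardLinSqrt_two`, whose proof `ringHardLinSqrtPlan` passes through the odd class without stating it;
`ringHardOdd_two_sqrt` below STATES the odd-class law at slope `K`: the tree's `walkHardLinSqrt` transported through the
walk chart with explicit degree `2D + 4`), the STRONGER special piece `SqrtShadowLoss3` (DECIDED) and its SMALLER residual. -/

/-- **`RingHardOdd 2` AT DEGREE `K·√n`, EVERY `K`** (stated here; cf. the tree's `ringHardLinSqrtPlan`): for every slope `K`
there are `θ_K < 1` and `n₀` such that for all `n ≥ n₀` and every degree `D` with `2D + 4 ≤ K·⌊√(n−1)⌋`, every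
`𝔽₂`-polynomial ring strategy of degree `≤ D` solves the ring relation on at most `θ_K · 2^(n-1)` inputs of the ODD class.
Proof: `OddPrimeTransport.walkTransportF` re-run with explicit degrees (`hasDegF_transport`: walk degree
`(p−1)·D·2 + 4 = 2D + 4` at `p = 2`) on top of the tree's `walkHardLinSqrt K`; the odd class injects into the walk game
(`uVec`, `rel_iff_ringWinU`, `xOfU_uVec`). -/
theorem ringHardOdd_two_sqrt (K : ℕ) : ∃ θ : ℝ, θ < 1 ∧ ∃ n₀ : ℕ, ∀ n ≥ n₀, ∀ D : ℕ,
    2 * D + 4 ≤ K * Nat.sqrt (n - 1) →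
    ∀ P : Fin n → CubeFn (ZMod 2) n, (∀ i, P i ∈ lowDeg (ZMod 2) n D) →
      ((univ.filter fun x : Fin n → Bool => OddZeros x ∧ Rel x (fun i => decide (P i x = 1))).card : ℝ)
        ≤ θ * (2 : ℝ) ^ (n - 1) := by
  obtain ⟨θ, hθ, n₀, hW⟩ := walkHardLinSqrt K
  refine ⟨θ, hθ, max (n₀ + 1) 3, fun N hN D hD P hP => ?_⟩
  obtain ⟨n, rfl⟩ : ∃ n, N = n + 1 := ⟨N - 1, by omega⟩
  have hn₀n : n₀ ≤ n := by have := le_max_left (n₀ + 1) 3; omega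
  have hn2 : 2 ≤ n := by have := le_max_right (n₀ + 1) 3; omega
  simp only [Nat.add_sub_cancel] at hD ⊢
  set z : (Fin (n + 1) → Bool) → (Fin (n + 1) → Bool) := fun x i => decide (P i x = 1) with hz
  set y : Fin (n + 1) → (Fin n → Bool) → Bool :=
    fun g u => xor (z (xOfU u) g) (tGuess (xOfU u) g) with hy
  have hdeg : ∀ g, HasDeg (y g) (K * Nat.sqrt n) := by
    intro g
    have h := hasDegF_transport (p := 2) (P g) (hP g) g
    have e : (2 - 1) * D * 2 + 2 * 2 = 2 * D + 4 := by omega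
    rw [e] at h
    exact lowDeg_mono hD h
  have hwin := hW n hn₀n (n + 2) y hdeg
  have hodd : (univ.filter fun x : Fin (n + 1) → Bool => OddZeros x ∧ Rel x (z x)).card ≤
      (univ.filter fun u : Fin n → Bool => ringWinU (n + 2) y u = true).card := by
    refine Finset.card_le_card_of_injOn uVec ?_ ?_
    · intro x hx
      rw [Finset.mem_coe, mem_filter] at hx
      rw [Finset.mem_coe, mem_filter]
      exact ⟨mem_univ _, (rel_iff_ringWinU hn2 x hx.2.1 z).1 hx.2.2⟩
    · intro x₁ hx₁ x₂ hx₂ h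
      rw [Finset.mem_coe, mem_filter] at hx₁ hx₂
      rw [← xOfU_uVec hn2 x₁ hx₁.2.1, ← xOfU_uVec hn2 x₂ hx₂.2.1, h]
  exact le_trans (by exact_mod_cast hodd) hwin

/-- the `𝔽₂`-degree budget at slope `K` and ring size `N`: `((K+1)·⌊√(N−1)⌋ − 4)/2` (so `2·budget + 4 ≤ (K+1)⌊√(N−1)⌋`). -/
def sqrtBudget (K N : ℕ) : ℕ := ((K + 1) * Nat.sqrt (N - 1) - 4) / 2

/-- the budget fits the hypothesis of `ringHardOdd_two_sqrt (K+1)` once `N ≥ 17`. -/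
theorem sqrtBudget_fits (K : ℕ) (hN : 17 ≤ N) : 2 * sqrtBudget K N + 4 ≤ (K + 1) * Nat.sqrt (N - 1) := by
  unfold sqrtBudget
  have h4 : 4 ≤ Nat.sqrt (N - 1) := by
    rw [Nat.le_sqrt]; omega
  have h4' : 4 ≤ (K + 1) * Nat.sqrt (N - 1) := le_trans h4 (Nat.le_mul_of_pos_left _ (by omega))
  omega

/-- the budget grows with the slope. -/
theorem sqrtBudget_mono {K K' : ℕ} (h : K ≤ K') (N : ℕ) : sqrtBudget K N ≤ sqrtBudget K' N := by
  unfold sqrtBudget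
  have : (K + 1) * Nat.sqrt (N - 1) ≤ (K' + 1) * Nat.sqrt (N - 1) := Nat.mul_le_mul_right _ (by omega)
  omega

/-- **CHEAPLY `𝔽₂`-LOW AT SQUARE-ROOT SCALE, slope `K`**: some gauge of `𝔽₃`-degree `≤ (log₂ N)^e` makes every output bit
an `𝔽₂`-polynomial of degree `≤ sqrtBudget K N ≈ (K+1)√N/2`. -/
def StabF2S (K e : ℕ) (P : Fin N → CubeFn (ZMod 3) N) : Prop :=
  ∃ s : Fin N → CubeFn (ZMod 3) N, (∀ i, s i ∈ lowDeg (ZMod 3) N ((Nat.log 2 N) ^ e)) ∧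
    ∀ k, shadow (pad P s) k ∈ lowDeg (ZMod 2) N (sqrtBudget K N)

/-- **the STRONGER special piece `SqrtShadowLoss3`** (a THEOREM, `sqrt_shadow_holds`): for every slope `K` and gauge level
`e`, strategies cheaply `𝔽₂`-low at scale `K√n` lose a polynomial (in fact constant) fraction of the odd class. -/
def SqrtShadowLoss3 : Prop :=
  ∃ C : ℕ, ∀ K e : ℕ, ∃ n₀ : ℕ, ∀ n ≥ n₀, ∀ P : Fin n → CubeFn (ZMod 3) n, StabF2S K e P →
    ((univ.filter fun x : Fin n → Bool => OddZeros x ∧ Rel x (fun i => decide (P i x = 1))).card : ℝ)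
      ≤ (1 - 1 / (n : ℝ) ^ C) * (2 : ℝ) ^ (n - 1)

/-- **the SMALLER residual `SqrtTernaryLoss3`**: G's text with `¬ StabF2S K (c+1) P` inserted (some slope `K`) — dense, not
cheaply counter-form, not cheaply `(m,r)`-table-form, and some output bit of `𝔽₂`-degree `> (K+1)√n/2` under EVERY cheap gauge. -/
def SqrtTernaryLoss3 : Prop :=
  ∃ K m r : ℕ, ∃ a : ℕ, ∃ C : ℕ, ∀ c : ℕ, ∃ n₀ : ℕ, ∀ n ≥ n₀, ∀ P : Fin n → CubeFn (ZMod 3) n,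
    (∀ i, P i ∈ lowDeg (ZMod 3) n ((Nat.log 2 n) ^ c)) →
      ¬ StabFew ((Nat.log 2 n) ^ a) 0 (c + 1) P → ¬ StabCounter (c + 1) P → ¬ StabTable m r (c + 1) P →
        ¬ StabF2S K (c + 1) P →
          ((univ.filter fun x : Fin n → Bool => OddZeros x ∧ Rel x (fun i => decide (P i x = 1))).card : ℝ)
            ≤ (1 - 1 / (n : ℝ) ^ C) * (2 : ℝ) ^ (n - 1)

/-- **`SqrtShadowLoss3` PROVED** (`C = 1`), from `ringHardOdd_two_sqrt (K+1)` exactly as `shadow_holds` from `ringHardOdd_two`. -/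
theorem sqrt_shadow_holds : SqrtShadowLoss3 := by
  refine ⟨1, fun K e => ?_⟩
  obtain ⟨θ, hθ, n₀, hall⟩ := ringHardOdd_two_sqrt (K + 1)
  obtain ⟨M, hM⟩ := exists_nat_ge (1 / (1 - θ))
  refine ⟨max n₀ (max M 17), fun n hn P hst => ?_⟩
  have hn₀' : n₀ ≤ n := le_trans (le_max_left _ _) hn
  have hM' : M ≤ n := le_trans (le_trans (le_max_left _ _) (le_max_right _ _)) hn
  have hn17 : 17 ≤ n := le_trans (le_trans (le_max_right _ _) (le_max_right _ _)) hn
  obtain ⟨s, -, hsh⟩ := hst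
  have h := hall n hn₀' (sqrtBudget K n) (sqrtBudget_fits K hn17) (fun k => shadow (pad P s) k) hsh
  have hset : (univ.filter fun x : Fin n → Bool =>
        OddZeros x ∧ Rel x (fun i => decide (shadow (pad P s) i x = 1)))
      = univ.filter fun x : Fin n → Bool => OddZeros x ∧ Rel x (fun i => decide (P i x = 1)) := by
    rw [← winset_pad P s]
    exact Finset.filter_congr fun x _ => by rw [decide_shadow]
  rw [hset] at h
  have hθn : θ ≤ 1 - 1 / (n : ℝ) ^ 1 := by
    rw [pow_one]
    have h1θ : 0 < 1 - θ := by linarith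
    have hnpos : (0 : ℝ) < n := by exact_mod_cast (show 0 < n by omega)
    have hMr : 1 / (1 - θ) ≤ (n : ℝ) := le_trans hM (by exact_mod_cast hM')
    rw [div_le_iff₀ h1θ] at hMr
    have h2 : 1 / (n : ℝ) ≤ 1 - θ := by
      rw [div_le_iff₀ hnpos]; linarith
    linarith
  exact le_trans h (mul_le_mul_of_nonneg_right hθn (by positivity))

/-- **`closesS` — the node's deciding theorem at square-root scale, onto G BY NAME.** -/
theorem closesS (hF : SqrtShadowLoss3) (hR : SqrtTernaryLoss3) : NonAbelianLoss3 := by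
  obtain ⟨C₁, hF⟩ := hF
  obtain ⟨K, m, r, a, C₂, hR⟩ := hR
  refine ⟨m, r, a, max C₁ C₂, fun c => ?_⟩
  obtain ⟨n₁, hn₁⟩ := hF K (c + 1)
  obtain ⟨n₂, hn₂⟩ := hR c
  refine ⟨max (max n₁ n₂) 1, fun n hn P hP hgen hnc hnt => ?_⟩
  have hn1 : 1 ≤ n := le_trans (le_max_right _ _) hn
  have hn₁' : n₁ ≤ n := le_trans (le_trans (le_max_left _ _) (le_max_left _ _)) hn
  have hn₂' : n₂ ≤ n := le_trans (le_trans (le_max_right _ _) (le_max_left _ _)) hn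
  by_cases hs : StabF2S K (c + 1) P
  · exact loss_shape_mono hn1 (le_max_left _ _) _ _ (by positivity) (hn₁ n hn₁' P hs)
  · exact loss_shape_mono hn1 (le_max_right _ _) _ _ (by positivity) (hn₂ n hn₂' P hP hgen hnc hnt hs)

/-- N-test: `G → SqrtTernaryLoss3` (restriction). -/
theorem sqrtTernary_of_G (hG : NonAbelianLoss3) : SqrtTernaryLoss3 := by
  obtain ⟨m, r, a, C, h⟩ := hG
  refine ⟨0, m, r, a, C, fun c => ?_⟩
  obtain ⟨n₀, hn₀⟩ := h c
  exact ⟨n₀, fun n hn P hP hgen hnc hnt _ => hn₀ n hn P hP hgen hnc hnt⟩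

/-- the square-root residual alone gives G (law node at square-root scale). -/
theorem closesS_residual (hR : SqrtTernaryLoss3) : NonAbelianLoss3 := closesS sqrt_shadow_holds hR

/-- EXACTNESS at square-root scale: `G ↔ SqrtShadowLoss3 ∧ SqrtTernaryLoss3`. -/
theorem splitS_iff : NonAbelianLoss3 ↔ (SqrtShadowLoss3 ∧ SqrtTernaryLoss3) :=
  ⟨fun h => ⟨sqrt_shadow_holds, sqrtTernary_of_G h⟩, fun h => closesS h.1 h.2⟩

/-- HONESTY at square-root scale: `SqrtTernaryLoss3 ↔ G`. -/
theorem residualS_iff : SqrtTernaryLoss3 ↔ NonAbelianLoss3 := ⟨closesS_residual, sqrtTernary_of_G⟩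

/-- onto item B (stmt-27009) at square-root scale. -/
theorem closesBS (hS : AbelianLoss3) (hF : SqrtShadowLoss3) (hR : SqrtTernaryLoss3) :
    Summit.QuantumAdvantage.QuantumAdvantage.Theses.SparsityDial.NonCounterGenericLoss3 :=
  Summit.QuantumAdvantage.QuantumAdvantage.Theorems.AbelianDial.closes hS (closesS hF hR)

/-- onto item D (stmt-27656) at square-root scale. -/
theorem closesDS (hA : Summit.QuantumAdvantage.QuantumAdvantage.Theses.SparsityDial.CounterLoss3) (hS : AbelianLoss3)
    (hF : SqrtShadowLoss3) (hR : SqrtTernaryLoss3) :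
    Summit.QuantumAdvantage.QuantumAdvantage.Theses.SparsityDial.DenseGenericLoss3 :=
  Summit.QuantumAdvantage.QuantumAdvantage.Theorems.AbelianDial.closesD hA hS (closesS hF hR)

/-- the polylog budget fits under every square-root budget for all large `n`: `(log₂ n)^e' ≤ sqrtBudget K n`. -/
theorem logpow_le_sqrtBudget (K e' : ℕ) : ∃ n₀ : ℕ, ∀ n ≥ n₀, (Nat.log 2 n) ^ e' ≤ sqrtBudget K n := by
  obtain ⟨n₁, hn₁⟩ := TubePlanProof.logPow_le_natSqrt (e' + 1)
  refine ⟨max n₁ (2 ^ 10), fun n hn => le_trans ?_ (sqrtBudget_mono (Nat.zero_le K) n)⟩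
  have hn₁' : n₁ ≤ n := le_trans (le_max_left _ _) hn
  have hn10 : 2 ^ 10 ≤ n := le_trans (le_max_right _ _) hn
  have hlog : 10 ≤ Nat.log 2 n := Nat.le_log_of_pow_le (by norm_num) hn10
  have h1 := hn₁ n hn₁'
  rw [pow_succ] at h1
  have hx : 1 ≤ (Nat.log 2 n) ^ e' := Nat.one_le_pow _ _ (by omega)
  have h10 : (Nat.log 2 n) ^ e' * 10 ≤ Nat.sqrt n :=
    le_trans (Nat.mul_le_mul_left _ hlog) h1
  have hs : Nat.sqrt n ≤ Nat.sqrt (n - 1) + 1 := by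
    have h := Nat.sqrt_succ_le_succ_sqrt (n - 1)
    have e : (n - 1).succ = n := by omega
    rw [e] at h
    exact h
  unfold sqrtBudget
  omega

/-- POLYLOG ⊆ SQUARE ROOT: a strategy cheaply `𝔽₂`-low at polylog level `(e, e')` is cheaply `𝔽₂`-low at square-root scale
(any slope), for all large `n`. -/
theorem stabF2S_of_stabF2 (K e e' : ℕ) : ∃ n₀ : ℕ, ∀ n ≥ n₀, ∀ P : Fin n → CubeFn (ZMod 3) n,
    StabF2 e e' P → StabF2S K e P := by
  obtain ⟨n₀, hn₀⟩ := logpow_le_sqrtBudget K e'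
  refine ⟨n₀, fun n hn P hP => ?_⟩
  obtain ⟨s, hs, hsh⟩ := hP
  exact ⟨s, hs, fun k => lowDeg_mono (hn₀ n hn) (hsh k)⟩

/-- the square-root law implies the polylog law (the polylog special piece `F2ShadowLoss3` is the WEAKER decided instance). -/
theorem shadow_of_sqrt (hF : SqrtShadowLoss3) : F2ShadowLoss3 := by
  obtain ⟨C, hF⟩ := hF
  refine ⟨C, fun e e' => ?_⟩
  obtain ⟨n₁, hn₁⟩ := hF 0 e
  obtain ⟨n₂, hn₂⟩ := stabF2S_of_stabF2 0 e e'
  exact ⟨max n₁ n₂, fun n hn P hP =>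
    hn₁ n (le_trans (le_max_left _ _) hn) P (hn₂ n (le_trans (le_max_right _ _) hn) P hP)⟩

/-- the square-root residual is the SMALLER one: the polylog residual `TernaryLoss3` implies it (its hypothesis class is
contained in the polylog residual's class for all large `n`).  Chain: `G → TernaryLoss3 → SqrtTernaryLoss3 → G`. -/
theorem sqrtTernary_of_ternary (hR : TernaryLoss3) : SqrtTernaryLoss3 := by
  obtain ⟨e', m, r, a, C, hR⟩ := hR
  refine ⟨0, m, r, a, C, fun c => ?_⟩
  obtain ⟨n₁, hn₁⟩ := hR c
  obtain ⟨n₂, hn₂⟩ := stabF2S_of_stabF2 0 (c + 1) e'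
  refine ⟨max n₁ n₂, fun n hn P hP hgen hnc hnt hns => ?_⟩
  exact hn₁ n (le_trans (le_max_left _ _) hn) P hP hgen hnc hnt
    (fun h => hns (hn₂ n (le_trans (le_max_right _ _) hn) P h))

/-- every square-root budget is below the matching family's certified linear `𝔽₂`-degree, once `N ≥ (K+2)² + 1`. -/
theorem sqrtBudget_le_linear (K : ℕ) (hN : (K + 2) ^ 2 + 1 ≤ N) : sqrtBudget K N ≤ (N - 1) / 2 - 3 := by
  unfold sqrtBudget
  have h1 : K + 2 ≤ Nat.sqrt (N - 1) := by
    rw [Nat.le_sqrt']; omega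
  have h2 : Nat.sqrt (N - 1) ^ 2 ≤ N - 1 := Nat.sqrt_le' (N - 1)
  have h4 : (K + 2) * Nat.sqrt (N - 1) ≤ Nat.sqrt (N - 1) * Nat.sqrt (N - 1) := Nat.mul_le_mul_right _ h1
  have h5 : (K + 2) * Nat.sqrt (N - 1) = (K + 1) * Nat.sqrt (N - 1) + Nat.sqrt (N - 1) := by ring
  have h6 : Nat.sqrt (N - 1) ^ 2 = Nat.sqrt (N - 1) * Nat.sqrt (N - 1) := sq _
  omega

/-- **the matching family is NOT cheaply-`𝔽₂`-low AT SQUARE-ROOT SCALE at the zero gauge, for EVERY slope `K`**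
(eventually in `n`): its certified `𝔽₂`-degree `> (n−1)/2 − 3` is linear, the budget `≈ (K+1)√n/2`. So `qStrat` inhabits
the hypothesis class of the SMALLER residual `SqrtTernaryLoss3` too (at the zero gauge). -/
theorem q_not_F2S_zero (K : ℕ) : ∃ n₀ : ℕ, ∀ n ≥ n₀,
    ¬ ∀ k : Fin n, shadow (pad (fun i : Fin n => qStrat i) (fun _ => 0)) k ∈ lowDeg (ZMod 2) n (sqrtBudget K n) := by
  refine ⟨max ((K + 2) ^ 2 + 1) 9, fun n hn h => ?_⟩
  have hN9 : 9 ≤ n := le_trans (le_max_right _ _) hn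
  have hK : (K + 2) ^ 2 + 1 ≤ n := le_trans (le_max_left _ _) hn
  exact q_shadow_degree_linear hN9 (lowDeg_mono (sqrtBudget_le_linear K hK) (h ⟨n - 1, by omega⟩))

end Summit.QuantumAdvantage.QuantumAdvantage.Theorems.ShadowDial
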